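import Mathlib.RingTheory.MvPolynomial.Symmetric.Defs
import Mathlib.Algebra.MvPolynomial.PDeriv
import Mathlib.Data.ZMod.Basic
import HarnessLib

/-!
# Chatterjee–Kumar–She–Volk 2022, Claim 22 / Lemma 21: the singular locus of the elementary symmetric polynomials — corrected hypothesis, and a counterexample to the printed one

P. Chatterjee, M. Kumar, A. She, B. L. Volk, *Quadratic lower bounds for algebraic branching programs
and formulas*, comput. complex. **31** (2022) 8 (= CCC 2020, arXiv:1911.11793)
[ChatterjeeKumarSheVolk2022], §5.1 (p0016 of the materialised arXiv text), attributing the statement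
to Meckler–Zaimi (MathOverflow 264226, 2017) and Limaye–Mittal–Pareek (manuscript, 2019).

**Lemma 21** (p0016): "Let `n, d ∈ ℕ` be natural numbers with `2 ≤ d ≤ n`. Then, over any field of
characteristic at least `d+1`, the dimension of the variety `V = 𝕍(∂_{x_i} ESYM(n,d) : i ∈ [n])` is
at most `d − 2`." It is derived from **Claim 22** (p0016): "Let `a ∈ 𝔽ⁿ` be a point in the variety
`V`. Then, at least `n − (d−2)` coordinates of `a` are equal to `0`," whose printed proof is an
induction on `d` driven by Euler's formula: `Σ_i ∂_{x_i} ESYM(n,d) = (n − d + 1)·ESYM(n, d−1)`.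

## What is proved here

* `CKSV2022.claim_22` — Claim 22 PROVED under the hypothesis that `1, 2, …, n` are non-zero in the
  field (`∀ k, 1 ≤ k ≤ n → (k : K) ≠ 0`: characteristic `0`, or positive characteristic `> n`): every
  common zero of all `∂_i e_d`, `2 ≤ d ≤ n`, has at least `n − (d−2)` zero coordinates
  (`CKSV2022.claim_22`: it is supported on a set of size `≤ d − 2`, the set-theoretic content of
  Lemma 21: `V ⊆ ⋃_{|S|=d−2} V_S`, p0016:L27–L31; `CKSV2022.claim_22_card`: the printed count). The proof is the printed induction, run on the
  support of the point (`CKSV2022.card_lt_of_esymAt_erase_eq_zero`), with the Euler step in the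
  double-counting form `Σ_{i∈U} e_r(a|_{U∖i}) = (|U| − r)·e_r(a|_U)` (`CKSV2022.sum_esymAt_erase`);
  the divisions by `|U| − r ∈ {1, …, n}` are exactly where the hypothesis on the characteristic enters.
* `CKSV2022.claim_22_counterexample` — the printed hypothesis "characteristic at least `d + 1`" does
  NOT suffice: for `n = 4`, `d = 2` over `𝔽₃` (characteristic `3 = d + 1`) the point `a = (1,1,1,1)`
  is a common zero of all `∂_i e_2 = Σ_{j≠i} x_j` (each evaluates to `3 = 0`) with no zero coordinate,
  whereas Claim 22 demands `n − (d−2) = 4` zero coordinates; the same point shows `V ⊇ 𝔽₃·(1,1,1,1)`,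
  of dimension `1 > d − 2 = 0`, against Lemma 21 (and Lemma 24 with `R_i = 0`) as printed. In general
  the printed Euler step divides by `n − d + 1`, which vanishes in characteristic `p ∣ n − d + 1` even
  when `p > d`. (PRINT ERRATUM candidate; the paper's Theorem 3 is stated for characteristic `> 0.1n`
  and uses Lemma 24 at `d = 0.1n`.)

D-0026: no named facts; everything is a definition with a body or a theorem.

## References
* [ChatterjeeKumarSheVolk2022] P. Chatterjee, M. Kumar, A. She, B. L. Volk, comput. complex. 31
  (2022) 8, doi:10.1007/s00037-022-00223-8, arXiv:1911.11793 — §5.1: Lemma 21, Claim 22, Fact 23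
  (Euler's formula), eq. (step1) `∂_i e_d = e_{d−1} − x_i ∂_i e_{d−1}`, Lemma 24.
-/

noncomputable section

open MvPolynomial Finset

namespace Literature.Computability.AlgebraicComplexity

namespace CKSV2022

section EsymAt

variable {σ : Type*} [DecidableEq σ] {M : Type*} [CommSemiring M]

/-- `e_r(x|_U) = Σ_{T ⊆ U, |T| = r} Π_{j ∈ T} x_j`: the elementary symmetric polynomial of degree `r`
in the coordinates `U` of `x` (the "`ESYM(n−k, d−1)` at the projection `a_S`" of the printed proof,
p0016:L60–L66). [cite: ChatterjeeKumarSheVolk2022, Claim 22 (proof)] -/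
def esymAt (U : Finset σ) (x : σ → M) (r : ℕ) : M := ∑ T ∈ U.powersetCard r, ∏ j ∈ T, x j

omit [DecidableEq σ] in
/-- `e_0 = 1`. [cite: ChatterjeeKumarSheVolk2022, §5.1] -/
theorem esymAt_zero (U : Finset σ) (x : σ → M) : esymAt U x 0 = 1 := by
  rw [esymAt, Finset.powersetCard_zero, Finset.sum_singleton, Finset.prod_empty]

/-- **Pascal's rule** `e_{r+1}(x|_U) = e_{r+1}(x|_{U∖i}) + x_i·e_r(x|_{U∖i})` for `i ∈ U` — the
identity behind eq. (step1), `∂_i e_d = e_{d−1} − x_i·∂_i e_{d−1}` (p0016:L50).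
[cite: ChatterjeeKumarSheVolk2022, Claim 22 (proof), eq. (step1)] -/
theorem esymAt_succ_eq (U : Finset σ) {i : σ} (hi : i ∈ U) (x : σ → M) (r : ℕ) :
    esymAt U x (r + 1) = esymAt (U.erase i) x (r + 1) + x i * esymAt (U.erase i) x r := by
  have hU : U = insert i (U.erase i) := (Finset.insert_erase hi).symm
  have hi' : i ∉ U.erase i := Finset.notMem_erase i U
  rw [esymAt, hU, Finset.powersetCard_succ_insert hi', Finset.sum_union, ← hU]
  · congr 1
    rw [esymAt, Finset.mul_sum, Finset.sum_image]
    · refine Finset.sum_congr rfl fun T hT => ?_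
      have hiT : i ∉ T := fun h => hi' ((Finset.mem_powersetCard.1 hT).1 h)
      rw [Finset.prod_insert hiT]
    · intro T hT T' hT' h
      have hiT : i ∉ T := fun h => hi' ((Finset.mem_powersetCard.1 (Finset.mem_coe.1 hT)).1 h)
      have hiT' : i ∉ T' := fun h => hi' ((Finset.mem_powersetCard.1 (Finset.mem_coe.1 hT')).1 h)
      rw [← Finset.erase_insert hiT, h, Finset.erase_insert hiT']
  · rw [Finset.disjoint_left]
    intro T hT hT'
    rw [Finset.mem_image] at hT'
    obtain ⟨T', _, rfl⟩ := hT'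
    exact hi' ((Finset.mem_powersetCard.1 hT).1 (Finset.mem_insert_self i T'))

/-- **Euler's formula, double-counting form** (Fact 23, p0016:L33–L35, as used at p0016:L52–L56:
"`Σ_i ∂_i e_d = n·e_{d−1} − (d−1)·e_{d−1}`"): `Σ_{i ∈ U} e_r(x|_{U∖i}) = (|U| − r)·e_r(x|_U)` — each
`r`-subset `T ⊆ U` is counted once for every `i ∈ U ∖ T`.
[cite: ChatterjeeKumarSheVolk2022, Fact 23, Claim 22 (proof)] -/
theorem sum_esymAt_erase (U : Finset σ) (x : σ → M) (r : ℕ) :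
    ∑ i ∈ U, esymAt (U.erase i) x r = ((U.card - r : ℕ) : M) * esymAt U x r := by
  have h1 : ∀ i ∈ U, esymAt (U.erase i) x r
      = ∑ T ∈ U.powersetCard r, if i ∉ T then ∏ j ∈ T, x j else 0 := by
    intro i _
    rw [esymAt, ← Finset.sum_filter]
    congr 1
    ext T
    simp only [Finset.mem_powersetCard, Finset.mem_filter, Finset.subset_erase]
    tauto
  rw [Finset.sum_congr rfl h1, Finset.sum_comm, esymAt, Finset.mul_sum]
  refine Finset.sum_congr rfl fun T hT => ?_
  obtain ⟨hTU, hTr⟩ := Finset.mem_powersetCard.1 hT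
  rw [← Finset.sum_filter, Finset.sum_const, nsmul_eq_mul]
  congr 2
  have : U.filter (fun i => i ∉ T) = U \ T := by
    ext i; simp [Finset.mem_sdiff]
  rw [this, Finset.card_sdiff, Finset.inter_eq_left.2 hTU, hTr]

omit [DecidableEq σ] in
/-- Coordinates where `x` vanishes do not contribute: `e_r(x|_U) = e_r(x|_S)` if `x = 0` on `U ∖ S`
("`a_S` … obtained by projecting `a` to the set `S` of its [non-zero] coordinates", p0016:L64–L66).
[cite: ChatterjeeKumarSheVolk2022, Claim 22 (proof)] -/
theorem esymAt_eq_of_subset {U S : Finset σ} (hSU : S ⊆ U) (x : σ → M)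
    (hx : ∀ j ∈ U, j ∉ S → x j = 0) (r : ℕ) : esymAt U x r = esymAt S x r := by
  rw [esymAt, esymAt]
  refine (Finset.sum_subset (Finset.powersetCard_mono hSU) fun T hTU hTS => ?_).symm
  obtain ⟨hTU', hTr⟩ := Finset.mem_powersetCard.1 hTU
  have : ¬ T ⊆ S := fun h => hTS (Finset.mem_powersetCard.2 ⟨h, hTr⟩)
  obtain ⟨j, hjT, hjS⟩ := Finset.not_subset.1 this
  exact Finset.prod_eq_zero hjT (hx j (hTU' hjT) hjS)

end EsymAt

section Polynomials

variable {σ : Type*} [Fintype σ] [DecidableEq σ] {K : Type*} [CommSemiring K]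

omit [DecidableEq σ] in
/-- `e_r` evaluated: `e_r(a) = e_r(a|_{univ})`. [cite: ChatterjeeKumarSheVolk2022, §5.1] -/
theorem eval_esymm_eq_esymAt (a : σ → K) (r : ℕ) :
    eval a (esymm σ K r) = esymAt Finset.univ a r := by
  simp only [esymm, esymAt, map_sum, map_prod, eval_X]

omit [Fintype σ] [DecidableEq σ] in
/-- A squarefree monomial `x^T` has zero `i`-th partial derivative when `i ∉ T`.
[cite: ChatterjeeKumarSheVolk2022, Claim 22 (proof)] -/
private theorem pderiv_prod_X_of_notMem (T : Finset σ) {i : σ} (hi : i ∉ T) :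
    pderiv i (∏ j ∈ T, (X j : MvPolynomial σ K)) = 0 := by
  refine Finset.prod_induction _ (fun f => pderiv i f = 0) (fun f g hf hg => ?_) (pderiv_one)
    (fun j hj => pderiv_X_of_ne (ne_of_mem_of_not_mem hj hi))
  rw [pderiv_mul, hf, hg, zero_mul, mul_zero, add_zero]

/-- **eq. (step1)** evaluated (p0016:L50, `∂_{x_i} ESYM(n,d) = ESYM(n,d−1) − x_i·∂_{x_i} ESYM(n,d−1)`,
i.e. `∂_i e_{r+1}` is `e_r` of the other variables): `(∂_i e_{r+1})(a) = e_r(a|_{univ ∖ i})`.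
[cite: ChatterjeeKumarSheVolk2022, Claim 22 (proof), eq. (step1)] -/
theorem eval_pderiv_esymm_succ (a : σ → K) (i : σ) (r : ℕ) :
    eval a (pderiv i (esymm σ K (r + 1))) = esymAt (Finset.univ.erase i) a r := by
  have h := esymAt_succ_eq (M := MvPolynomial σ K) Finset.univ (Finset.mem_univ i) X r
  have h0 : esymm σ K (r + 1) = esymAt Finset.univ (X : σ → MvPolynomial σ K) (r + 1) := rfl
  have hz : ∀ s, pderiv i (esymAt (Finset.univ.erase i) (X : σ → MvPolynomial σ K) s) = 0 := by
    intro s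
    rw [esymAt, map_sum]
    exact Finset.sum_eq_zero fun T hT =>
      pderiv_prod_X_of_notMem T fun h => Finset.notMem_erase i _ ((Finset.mem_powersetCard.1 hT).1 h)
  rw [h0, h, map_add, pderiv_mul, pderiv_X_self, one_mul, hz, hz, zero_add, mul_zero, add_zero]
  simp only [esymAt, map_sum, map_prod, eval_X]

end Polynomials

section Claim22

variable {σ : Type*} [Fintype σ] [DecidableEq σ] {K : Type*} [Field K]

omit [Fintype σ] in
/-- **The induction of Claim 22, run on the support** (p0016:L43–L75): if `x` is nowhere zero on
`U`, all of `1, …, |U|` are non-zero in `K`, and both `e_r(x|_{U∖i}) = 0` for every `i ∈ U` and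
`e_r(x|_U) = 0`, then `|U| < r`. Step: Pascal's rule gives `x_i·e_{r−1}(x|_{U∖i}) = 0`, Euler's
formula gives `(|U| − (r−1))·e_{r−1}(x|_U) = 0`. [cite: ChatterjeeKumarSheVolk2022, Claim 22 (proof)] -/
theorem card_lt_of_esymAt_erase_eq_zero (x : σ → K) :
    ∀ (r : ℕ) (U : Finset σ), (∀ j ∈ U, x j ≠ 0) → (∀ k : ℕ, 1 ≤ k → k ≤ U.card → (k : K) ≠ 0) →
      (∀ i ∈ U, esymAt (U.erase i) x r = 0) → esymAt U x r = 0 → U.card < r := by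
  intro r
  induction r with
  | zero =>
    intro U _ _ _ h0
    rw [esymAt_zero] at h0
    exact absurd h0 one_ne_zero
  | succ r ih =>
    intro U hx hK herase hU
    by_cases hUr : U.card ≤ r
    · omega
    -- Pascal: `x_i · e_r(x|_{U∖i}) = 0`, so `e_r(x|_{U∖i}) = 0`
    have herase' : ∀ i ∈ U, esymAt (U.erase i) x r = 0 := by
      intro i hi
      have h := esymAt_succ_eq U hi x r
      rw [hU, herase i hi, zero_add] at h
      exact (mul_eq_zero.1 h.symm).resolve_left (hx i hi)
    -- Euler: `(|U| − r) · e_r(x|_U) = Σ_i e_r(x|_{U∖i}) = 0`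
    have hEuler := sum_esymAt_erase U x r
    rw [Finset.sum_eq_zero fun i hi => herase' i hi] at hEuler
    have hU' : esymAt U x r = 0 :=
      (mul_eq_zero.1 hEuler.symm).resolve_left (hK (U.card - r) (by omega) (by omega))
    have := ih U hx hK herase' hU'
    omega

/-- **CKSV 2022, Claim 22, support form** (p0016: "Let `a ∈ 𝔽ⁿ` be a point in the variety
`V = 𝕍(∂_{x_i} ESYM(n,d) : i ∈ [n])` … Then, at least `n − (d−2)` coordinates of `a` are equal to
`0`", `2 ≤ d ≤ n`; equivalently, Lemma 21's set-theoretic content p0016:L27–L31: "the variety `V` is a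
subset of `∪_{S ⊆ [n], |S| = d−2} V_S`"), PROVED under the CORRECTED hypothesis that `1, …, n` are
non-zero in the field (characteristic `0` or larger than `n`) in place of the printed "characteristic
at least `d + 1`", which does not suffice (`claim_22_counterexample`): `a` is supported on a set of at
most `d − 2` coordinates. [cite: ChatterjeeKumarSheVolk2022, Claim 22, Lemma 21] -/
theorem claim_22 {n d : ℕ} (hσ : Fintype.card σ = n) (hd : 2 ≤ d) (hdn : d ≤ n)
    (hK : ∀ k : ℕ, 1 ≤ k → k ≤ n → (k : K) ≠ 0) (a : σ → K)
    (ha : ∀ i, eval a (pderiv i (esymm σ K d)) = 0) :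
    ∃ S : Finset σ, S.card ≤ d - 2 ∧ ∀ i, i ∉ S → a i = 0 := by
  classical
  obtain ⟨r, rfl⟩ : ∃ r, d = r + 1 := ⟨d - 1, by omega⟩
  set S := Finset.univ.filter fun i => a i ≠ 0 with hSdef
  have hS : ∀ j ∈ S, a j ≠ 0 := fun j hj => (Finset.mem_filter.1 hj).2
  have hzero : ∀ j, j ∉ S → a j = 0 := fun j hj => by
    by_contra h; exact hj (Finset.mem_filter.2 ⟨Finset.mem_univ _, h⟩)
  refine ⟨S, ?_, hzero⟩
  -- the partials in terms of the support
  have ha' : ∀ i, esymAt (Finset.univ.erase i) a r = 0 := fun i => by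
    rw [← eval_pderiv_esymm_succ]; exact ha i
  have herase : ∀ i ∈ S, esymAt (S.erase i) a r = 0 := by
    intro i hi
    rw [← ha' i]
    refine (esymAt_eq_of_subset (Finset.erase_subset_erase i (Finset.subset_univ S)) a
      (fun j hj hjS => hzero j fun h => hjS (Finset.mem_erase.2 ⟨(Finset.mem_erase.1 hj).1, h⟩))
      r).symm
  have hScard : S.card ≤ n := hσ ▸ Finset.card_le_univ S
  -- `e_r(a|_S) = 0`: from a zero coordinate if there is one, else from Euler's formula
  have hSr : esymAt S a r = 0 := by
    by_cases hfull : S = Finset.univ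
    · have hEuler := sum_esymAt_erase (Finset.univ : Finset σ) a r
      rw [Finset.sum_eq_zero fun i _ => ha' i, Finset.card_univ, hσ] at hEuler
      rw [hfull]
      exact (mul_eq_zero.1 hEuler.symm).resolve_left (hK (n - r) (by omega) (by omega))
    · obtain ⟨i₀, hi₀⟩ : ∃ i₀, i₀ ∉ S := by
        by_contra h
        exact hfull (Finset.eq_univ_of_forall fun i => not_not.1 fun hi => h ⟨i, hi⟩)
      rw [← ha' i₀]
      refine (esymAt_eq_of_subset (fun j hj => Finset.mem_erase.2 ⟨?_, Finset.mem_univ _⟩) a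
        (fun j _ hjS => hzero j hjS) r).symm
      rintro rfl
      exact hi₀ hj
  have hlt := card_lt_of_esymAt_erase_eq_zero a r S hS
    (fun k hk hkS => hK k hk (hkS.trans hScard)) herase hSr
  omega

/-- **CKSV 2022, Claim 22, as a count** (p0016: "at least `n − (d−2)` coordinates of `a` are equal
to `0`"), under the corrected hypothesis. [cite: ChatterjeeKumarSheVolk2022, Claim 22] -/
theorem claim_22_card [DecidableEq K] {n d : ℕ} (hσ : Fintype.card σ = n) (hd : 2 ≤ d) (hdn : d ≤ n)
    (hK : ∀ k : ℕ, 1 ≤ k → k ≤ n → (k : K) ≠ 0) (a : σ → K)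
    (ha : ∀ i, eval a (pderiv i (esymm σ K d)) = 0) :
    n - (d - 2) ≤ (Finset.univ.filter fun i => a i = 0).card := by
  obtain ⟨S, hS, hSa⟩ := claim_22 hσ hd hdn hK a ha
  have hsub : Sᶜ ⊆ Finset.univ.filter fun i => a i = 0 := fun i hi =>
    Finset.mem_filter.2 ⟨Finset.mem_univ _, hSa i (Finset.mem_compl.1 hi)⟩
  have := Finset.card_le_card hsub
  rw [Finset.card_compl, hσ] at this
  omega

/-- In characteristic `0` the corrected hypothesis always holds.
[cite: ChatterjeeKumarSheVolk2022, Claim 22] -/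
theorem claim_22_charZero [CharZero K] {n d : ℕ} (hσ : Fintype.card σ = n) (hd : 2 ≤ d)
    (hdn : d ≤ n) (a : σ → K) (ha : ∀ i, eval a (pderiv i (esymm σ K d)) = 0) :
    ∃ S : Finset σ, S.card ≤ d - 2 ∧ ∀ i, i ∉ S → a i = 0 :=
  claim_22 hσ hd hdn (fun k hk _ => by exact_mod_cast (show k ≠ 0 by omega)) a ha

end Claim22

section Counterexample

/-- **Claim 22 / Lemma 21 are false as printed** ("over any field of characteristic at least
`d+1`"): with `n = 4`, `d = 2` over `𝔽₃` (characteristic `3 = d + 1`), the all-ones point is a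
common zero of all `∂_i e_2 = Σ_{j ≠ i} x_j` (value `3 = 0`) but has NO zero coordinate, whereas
Claim 22 demands `n − (d − 2) = 4` of them (and the line through it lies in `V`, of dimension
`1 > d − 2 = 0`, against Lemma 21). The printed Euler step divides by `n − d + 1 = 3`.
[cite: ChatterjeeKumarSheVolk2022, Claim 22, Lemma 21] -/
theorem claim_22_counterexample :
    ringChar (ZMod 3) = 2 + 1 ∧
    (∀ i : Fin 4, eval (fun _ => (1 : ZMod 3)) (pderiv i (esymm (Fin 4) (ZMod 3) 2)) = 0) ∧
    (Finset.univ.filter fun i : Fin 4 => (fun _ => (1 : ZMod 3)) i = 0).card = 0 ∧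
    ¬ (4 - (2 - 2) ≤ (Finset.univ.filter fun i : Fin 4 => (fun _ => (1 : ZMod 3)) i = 0).card) := by
  refine ⟨ZMod.ringChar_zmod_n 3, fun i => ?_, by simp, by simp⟩
  rw [eval_pderiv_esymm_succ, esymAt]
  simp only [Finset.prod_const_one, Finset.sum_const, Finset.card_powersetCard]
  rw [Finset.card_erase_of_mem (Finset.mem_univ i), Finset.card_univ, Fintype.card_fin]
  decide

end Counterexample

end CKSV2022

end Literature.Computability.AlgebraicComplexity
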